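import Summits.QuantumFields.YangMills.Theorems.SwapVirialDeficitSectorStiffnessCoreSplit
import Summits.QuantumFields.YangMills.Theorems.SwapVirialDeficitSectorLaplaceBTubeCapStiffClosed
import Summits.QuantumFields.YangMills.Theorems.SwapVirialDeficitSectorLaplaceEndCoreGaussCore
import Summits.QuantumFields.YangMills.Theorems.SwapVirialDeficitSectorLaplaceEndGaussPlug
import Summits.QuantumFields.YangMills.Theorems.SwapVirialDeficitSectorLaplaceEndGaussN2Final
import Summits.QuantumFields.YangMills.Theorems.SwapVirialDeficitSectorLaplaceTipGlue
import Summits.QuantumFields.YangMills.Theorems.SwapVirialDeficitSectorLaplaceTipLeaderLayer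
import Summits.QuantumFields.YangMills.Theorems.SwapVirialDeficitSectorLaplaceTipPXLeaderLayer
import Summits.QuantumFields.YangMills.Theorems.SwapVirialDeficitSectorLaplaceTipPYLeaderLayer
import Summits.QuantumFields.YangMills.Theorems.SwapVirialDeficitSectorLaplaceTrStiffClosed
import Summits.QuantumFields.YangMills.Theorems.SwapVirialDeficitSectorStiffnessTrChart
import Summits.QuantumFields.YangMills.Theorems.SwapVirialDeficitBlowUpGnomonicTrBadSignLargeField
import Summits.QuantumFields.YangMills.Theorems.SwapVirialDeficitSectorLaplaceBulkStiffness
import Summits.QuantumFields.YangMills.Theorems.SwapVirialDeficitSectorStiffnessWindows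
import Summits.QuantumFields.YangMills.Theorems.SwapVirialDeficitLocalTwoSidedStiffness
import Summits.QuantumFields.YangMills.Theorems.SwapVirialDeficitSwapMeanActionGapGlue
import Summits.QuantumFields.YangMills.Theorems.VirialFluxGapToronSoftnessSharp
import HarnessLib

/-!
# (S)-ROAD ASSEMBLY ➎ v15 «ONE BULK + B-TUBES + TIP∕END CORES + 001 TRANSLATED CHART» — ⟨stmt-QuantumFields-24197⟩ `SwapGluedStiffness` and ⟨24194⟩ `SwapMeanActionGap` BY NAME
# (cell ym-idea-1; assembler fcl-p3 g49 ← g48 ← g47; LEAD sfw-p2 g98∕g99∕g100; width seats w2 g57–g61, w3 g64–g68)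

This is skeleton ➎ (HOME `fcl-p3-g49-SectorStiffnessSkeleton.lean`, v14 = 1 sorry) with its LAST stub closed BY NAME (v15, 2026-09-01):
★★★ `stub_core_tip := stub_core_tip_of_core (hubIntegral_hubAt_core_ceiling_of_PX_PY leaderLayer_PX leaderLayer_PY)` — the TIP core through the glue
✓`…SectorLaplaceTipGlue` (g49) on the (hCore) socket, (hCore) by ✓`…TipLeaderLayer` (g49: ✓`leaderLayer_aligned` LEAD g100 ∘ ✓`leaderLayer_ORIG` LEAD g100) from the two
aligned-frame region sockets ✓`leaderLayer_PX` (w2 g61 ✓`…TipPXLeaderLayer`) and ✓`leaderLayer_PY` (✓`…TipPYLeaderLayer`), through ✓`hubIntegral_hubAt_core_ceiling_of_leaderLayer_meas`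
(w2 g61 ✓`…TipCoreAssembly`, LEAD g100 ✓`…TipCoreAssemblyMeas`).  Earlier closures (v10–v14): `stub_bulk_stiff_sur` = ✓`bulk_stiff_sur` (g47), `stub_B_stiff` = ✓`bTubeCap_stiffness` (g48),
`stub_end_gaussCore` = ✓`stub_end_gaussCore_of_N2 endGauss_N2` (g49 plug on LEAD g99's N2 socket, w3 g67∕g68, w2 g60), `stub_h001_good` = ✓`h001_good` (g48 chain),
`stub_h001_bad` = ✓`h001_bad` (w3 g67); `stub_core_end`, `stub_core_weight`, `stub_h001_window`, `h000_window` are compositions (LEAD g98∕g99 ✓`stub_core_end_of_gaussCore`,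
✓`core_weight_of_tip_end_family`, ✓`h001_of_trChart_stubs_chi`, ✓`h000_of_core_stubs`), and the targets follow by ✓`swapGluedStiffness_of_windows` and
✓`swapMeanActionGapGlue_proof` ∘ ✓`toronSoftnessSharp_proof`.  The statements of §1–§3 are those of skeleton ➎ v8–v14 VERBATIM; only proofs-by-name were filled in.

ARCHITECTURE (LEAD g98 memo6): `(TS)_z : κ_L·∫e^{−βF_z}dμ_L ≤ β·∫F_z e^{−βF_z}dμ_L`, `κ_L = stiffKappa L (1∕8)`, is ADDITIVE in the measure.  Sector 000, joint gnomonic chart,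
GOOD sign patterns, chart measure `chartMeasure L = cone ⊗ ρdη` on `ℍ × GnoCoord L`: `(HubBulk τ × fibre) ⊔ BTubeCap L τ 1 ⊔ Core`, `Core = ((TipHub τ ∪ EndHub τ) × fibre) ∖ BTubeCap`,
one cut `τ = τ₀∕L^k`; bad signs = remainder (✓`badSign_remainder`).  The BULK carries its own two-sided law with SURPLUS `1∕16`; the B-TUBES carry plain stiffness; the CORE
borrows the bulk's surplus through pure WEIGHT bounds (`1∕32 + 1∕32`).  Sector 001 in the translated chart.  Composition ✓`h000_of_core_stubs` → ✓`swapGluedStiffness_of_windows`.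

HONEST LABEL: this file proves the route decls ⟨24197⟩ `Theses.SwapVirialDeficit.SwapGluedStiffness` and ⟨24194⟩ `Theses.SwapVirialDeficit.SwapMeanActionGap` of the thesis
`SwapVirialDeficit` from LANDED theorems, by name; it does NOT prove the summit: the Yang–Mills mass gap is NOT proved; no summit is proved by a line.  Item of record of this
seat ⟨24085⟩ `SubOctaveBounded` is aside ∕ untouched.  THEOREMS ONLY (0 `def`, 0 `sorry`, no instance, no notation), standard axioms.  `--workitem stmt-QuantumFields-24197`.
References: [cite: Luscher1983, §2]; [folklore].
-/

set_option autoImplicit false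
set_option synthInstance.maxSize 1024

noncomputable section

open MeasureTheory Quaternion Set
open scoped Quaternion BigOperators ENNReal
open Literature.MathematicalPhysics.QuantumLattice
open Literature.MathematicalPhysics.QuantumFieldTheory hiding SU2
open Summit.QuantumFields.YangMills.Theorems.SwapTwistDeficit.ToronLog

namespace Summit.QuantumFields.YangMills.Theorems.SwapVirialDeficit.SectorLaplace

open Summit.QuantumFields.YangMills.Theorems.FemtoTransferGap
open Summit.QuantumFields.YangMills.Theorems.FemtoTransferGap.TT
open Summit.QuantumFields.YangMills.Theorems.VirialFluxGap.RingDeficit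
open Summit.QuantumFields.YangMills.Theorems.SwapVirialDeficit.SwapRing
open Summit.QuantumFields.YangMills.Theorems.SwapVirialDeficit.BlowUpRing

variable {L : ℕ} [NeZero L]

/-! ## §1 Sector 000: the cores (the bulk ✓`bulk_stiff_sur` and the B-tubes ✓`bTubeCap_stiffness` are used by name in §3) -/

/-- (S-core-tip) ✓ CLOSED BY NAME (v15) — the TIP core `TipHub τ × fibre` weighs at most `1∕32` of the good bulk mass: ✓`stub_core_tip_of_core` (g49 ✓`…TipGlue`: law of the
mid window ✓`tipMid_window_le` w3 g68, corner∕mid∕core layers, rates, tails) on (hCore) = ✓`hubIntegral_hubAt_core_ceiling_of_PX_PY leaderLayer_PX leaderLayer_PY`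
(g49 ✓`…TipLeaderLayer` ∘ LEAD g100 ✓`leaderLayer_aligned` ∕ ✓`leaderLayer_ORIG` ∕ ✓`…TipCoreAssemblyMeas` ∘ w2 g61 ✓`…TipCoreAssembly` ∕ ✓`leaderLayer_PX` ∘ ✓`leaderLayer_PY`). -/
theorem stub_core_tip : ∃ K : ℝ, 0 < K ∧ ∃ k : ℕ, ∃ τ₀ : ℝ, 0 < τ₀ ∧ τ₀ ≤ 1 / 2 ∧ ∀ (L : ℕ) [NeZero L] (τ : ℝ), 0 < τ → τ ≤ τ₀ / (L : ℝ) ^ k →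
    ∀ b : ℝ, K * (L : ℝ) ^ k * τ⁻¹ ^ k ≤ b →
      stiffKappa L (1 / 8) * ∑ ε ∈ (Finset.univ.filter fun ε : GnoSign L => GoodSign ε),
          ∫ x in TipHub τ ×ˢ (univ : Set (GnoCoord L)), Real.exp (-(b * gnoDeficit z₀ (fun _ => 1) x.1 ε x.2)) ∂chartMeasure L ≤
        (1 / 32 : ℝ) * ∑ ε ∈ (Finset.univ.filter fun ε : GnoSign L => GoodSign ε), ∫ a in HubBulk τ, hubIntegral a ε b ∂coneMeasure :=
  stub_core_tip_of_core (hubIntegral_hubAt_core_ceiling_of_PX_PY leaderLayer_PX leaderLayer_PY)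

/-- (S-end-G♭) ✓ CLOSED BY NAME (v14) = ✓`stub_end_gaussCore_of_N2 endGauss_N2` [w3 g67 leader side + N2 near∕far, w2 g60 followers∕K7g, LEAD g99 glue∕socket∕tails, w3 g68 (P), g48 (δ)∕(I2)∕(I4), g49 plug]
— THE END GAUSSIAN CORE `G♭ = ({end window} ∖ RgCap(τ,1)) ∩ {u₁² + u₂² ≤ 1 + x₀²}` in the letters `(δ, η)` against `μ_B`, weighed against the Morse–Bott MAIN TERM of the
bulk with weight `1∕128` (LEAD g99 22:22Z self-correction: the Gaussian HALF over-covers the flat B-stratum; hub shell (iii) and the bulk law are discharged inside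
✓`stub_core_end_of_gaussCore`; composition plan memo11∕11a, rate form ✓`gaussCore_of_rate`). -/
theorem stub_end_gaussCore : ∃ K : ℝ, 0 < K ∧ ∃ k : ℕ, ∃ τ₀ : ℝ, 0 < τ₀ ∧ τ₀ ≤ 1 / 2 ∧ ∀ (L : ℕ) [NeZero L] (τ : ℝ), 0 < τ → τ ≤ τ₀ / (L : ℝ) ^ k →
    ∀ b : ℝ, K * (L : ℝ) ^ k * τ⁻¹ ^ k ≤ b → ∀ ε : GnoSign L, GoodSign ε →
      stiffKappa L (1 / 8) * (coneConst * Real.pi *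
        ∫ p in {p : ℝ × GnoCoord L | 4 * p.1 ^ 2 / (1 + p.1 ^ 2) ^ 2 < τ ∧ τ ≤ (1 + p.1 ^ 2)⁻¹} \
                ({p : ℝ × GnoCoord L | 4 * p.1 ^ 2 / (1 + p.1 ^ 2) ^ 2 < τ ∧ τ ≤ (1 + p.1 ^ 2)⁻¹ ∧ |p.1| < τ * Real.sqrt (1 + p.1 ^ 2)} ∩
                  {p : ℝ × GnoCoord L | τ ≤ Real.sqrt (p.2.1.1 1 ^ 2 + p.2.1.1 2 ^ 2)} ∩
                  {p : ℝ × GnoCoord L | |p.2.1.1 0| ≤ 1 * Real.sqrt (1 + p.2.1.1 1 ^ 2 + p.2.1.1 2 ^ 2)}) ∩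
              {p : ℝ × GnoCoord L | p.2.1.1 1 ^ 2 + p.2.1.1 2 ^ 2 ≤ 1 + p.2.1.1 0 ^ 2},
            Real.exp (-(b * gnoDeficit z₀ (fun _ => 1) (hubAt p.1 1) ε p.2))
            ∂((volume : Measure (ℝ × GnoCoord L)).withDensity fun p => ENNReal.ofReal (((1 + p.1 ^ 2)⁻¹) ^ 2 * gnoDensity p.2))) ≤
        (1 / 128 : ℝ) * ((2 * Real.pi / b) ^ alpha L * ∫ a in HubBulk τ, (∫ p : ℝ × ℝ, mbDensity a ε p) ∂coneMeasure) :=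
  stub_end_gaussCore_of_N2 endGauss_N2

/-- (S-core-end) ASSEMBLED — the END core `(EndHub τ × fibre) ∖ BTubeCap L τ 1` weighs at most `1∕32` of the good bulk mass, from `stub_end_gaussCore` by LEAD g99's
✓`stub_core_end_of_gaussCore` (✓`…EndCoreGaussCore` p836137; hub shell (iii) → threshold tail; bulk law ✓`bulk_fibred_plane` applied once). -/
theorem stub_core_end : ∃ K : ℝ, 0 < K ∧ ∃ k : ℕ, ∃ τ₀ : ℝ, 0 < τ₀ ∧ τ₀ ≤ 1 / 2 ∧ ∀ (L : ℕ) [NeZero L] (τ : ℝ), 0 < τ → τ ≤ τ₀ / (L : ℝ) ^ k →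
    ∀ b : ℝ, K * (L : ℝ) ^ k * τ⁻¹ ^ k ≤ b →
      stiffKappa L (1 / 8) * ∑ ε ∈ (Finset.univ.filter fun ε : GnoSign L => GoodSign ε),
          ∫ x in (EndHub τ ×ˢ (univ : Set (GnoCoord L))) \ BTubeCap L τ 1, Real.exp (-(b * gnoDeficit z₀ (fun _ => 1) x.1 ε x.2)) ∂chartMeasure L ≤
        (1 / 32 : ℝ) * ∑ ε ∈ (Finset.univ.filter fun ε : GnoSign L => GoodSign ε), ∫ a in HubBulk τ, hubIntegral a ε b ∂coneMeasure :=
  stub_core_end_of_gaussCore stub_end_gaussCore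

/-- (S-core) ASSEMBLED: the whole core `((Tip ∪ End) × fibre) ∖ BTubeCap L τ 1` weighs at most `1∕16` of the good bulk mass, from the two halves by
✓`core_weight_of_tip_end_family` (✓`…SectorStiffnessCoreSplit` §4). -/
theorem stub_core_weight : ∃ K : ℝ, 0 < K ∧ ∃ k : ℕ, ∃ τ₀ : ℝ, 0 < τ₀ ∧ τ₀ ≤ 1 / 2 ∧ ∀ (L : ℕ) [NeZero L] (τ : ℝ), 0 < τ → τ ≤ τ₀ / (L : ℝ) ^ k →
    ∀ b : ℝ, K * (L : ℝ) ^ k * τ⁻¹ ^ k ≤ b →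
      stiffKappa L (1 / 8) * ∑ ε ∈ (Finset.univ.filter fun ε : GnoSign L => GoodSign ε),
          ∫ x in ((TipHub τ ∪ EndHub τ) ×ˢ (univ : Set (GnoCoord L))) \ BTubeCap L τ 1, Real.exp (-(b * gnoDeficit z₀ (fun _ => 1) x.1 ε x.2)) ∂chartMeasure L ≤
        (1 / 16 : ℝ) * ∑ ε ∈ (Finset.univ.filter fun ε : GnoSign L => GoodSign ε), ∫ a in HubBulk τ, hubIntegral a ε b ∂coneMeasure :=
  core_weight_of_tip_end_family (fun L τ => BTubeCap L τ 1) (fun L τ => measurableSet_BTubeCap (L := L) τ 1)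
    (fun L _ τ => BTubeCap_subset_endHub_prod L τ 1) stub_core_tip stub_core_end

/-! ## §2 Sector 001 (✓`h001_good`, ✓`h001_bad` by name) -/

/-- `(TS)_001` as ONE polynomial window — ASSEMBLED from ✓`h001_good` (g48 chain ✓`…TrStiffClosed`) and ✓`h001_bad` (w3 g67) by ✓`h001_of_trChart_stubs_chi` (✓`…SectorStiffnessTrChart` §5, unit `uJ`,
character `sectorChar z₁`, class `GoodSign`). -/
theorem stub_h001_window : ∃ K : ℝ, 0 < K ∧ ∃ q : ℕ, ∀ (L : ℕ) [NeZero L] (b : ℝ), K * (L : ℝ) ^ q ≤ b →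
    (9 * (L : ℝ) ^ 4 - 3 / 2 + 1 / 8) * ∫ P, Real.exp (-(b * swapRingDeficit L z₁ P)) ∂(ringMeasure L) ≤
      b * ∫ P, swapRingDeficit L z₁ P * Real.exp (-(b * swapRingDeficit L z₁ P)) ∂(ringMeasure L) :=
  h001_of_trChart_stubs_chi norm_uJ (fun L => sectorChar (L := L) z₁) (fun L => sectorChar_central (L := L) z₁) (fun L => @GoodSign L)
    h001_good h001_bad

/-! ## §3 ✓ The composition -/

/-- ✓ `(TS)_000` on a polynomial window from ✓`bulk_stiff_sur` (g47), ✓`bTubeCap_stiffness` (g48) and `stub_core_weight` (✓`h000_of_core_stubs`). -/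
theorem h000_window : ∃ K : ℝ, 0 < K ∧ ∃ q : ℕ, ∀ (L : ℕ) [NeZero L] (b : ℝ), K * (L : ℝ) ^ q ≤ b →
    (9 * (L : ℝ) ^ 4 - 3 / 2 + 1 / 8) * ∫ P, Real.exp (-(b * swapRingDeficit L z₀ P)) ∂(ringMeasure L) ≤
      b * ∫ P, swapRingDeficit L z₀ P * Real.exp (-(b * swapRingDeficit L z₀ P)) ∂(ringMeasure L) :=
  h000_of_core_stubs (fun L τ => BTubeCap L τ 1) (fun L τ => measurableSet_BTubeCap (L := L) τ 1) (fun L _ τ => BTubeCap_subset L τ 1)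
    bulk_stiff_sur bTubeCap_stiffness stub_core_weight

/-- ★★★ ⟨24197⟩ `SwapGluedStiffness` BY NAME (✓`swapGluedStiffness_of_windows` on the two sector windows; every stub above is closed by name). -/
theorem swapGluedStiffness_of_stubs : Summit.QuantumFields.YangMills.Theses.SwapVirialDeficit.SwapGluedStiffness :=
  swapGluedStiffness_of_windows h000_window stub_h001_window

/-- ★★★ ⟨24194⟩ `SwapMeanActionGap` BY NAME (✓`swapMeanActionGapGlue_proof` ✓`toronSoftnessSharp_proof` on `swapGluedStiffness_of_stubs`, LEAD g98 19:07Z (i)). -/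
theorem swapMeanActionGap_of_stubs : Summit.QuantumFields.YangMills.Theses.SwapVirialDeficit.SwapMeanActionGap :=
  Summit.QuantumFields.YangMills.Theorems.SwapVirialDeficit.swapMeanActionGapGlue_proof
    Summit.QuantumFields.YangMills.Theorems.VirialFluxGap.FrameHessian.toronSoftnessSharp_proof swapGluedStiffness_of_stubs

end Summit.QuantumFields.YangMills.Theorems.SwapVirialDeficit.SectorLaplace

end
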